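import Literature.NumberTheory.Sieve.BuchstabFunction
import Literature.NumberTheory.LFunctions.PrimeSumSmoothWeight
import Mathlib.MeasureTheory.Integral.IntervalIntegral.IntegrationByParts
import HarnessLib

/-!
# The prime sum `∑_{y ≤ p < z} ω(log(x/p)/log p) · x/(p log p)` of the Buchstab iteration

Topic `Literature/NumberTheory/Sieve`. Everything here is PROVED (no definitions, no named facts).
This is the analytic core of the inductive step in the proof of the asymptotic formula for rough
numbers `Φ(x, y) = (x ω(u) − y)/log y + O(x/log² y)`, `u = log x/log y` (Lichtman,
*A modification of the linear sieve*, Lemma 6.1 = [WuI]; Harman, *Prime-Detecting Sieves*, §1.4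
and Appendix A.2; Tenenbaum, *Introduction to analytic and probabilistic number theory*, III.6.2):
after Buchstab's identity `Φ(x, y) = Φ(x, z) + ∑_{y ≤ p < z} Φ(x/p, p)` with `z = x^{1/k}` and the
induction hypothesis `Φ(x/p, p) ≈ (x/p) ω(u_p)/log p`, `u_p = log x/log p − 1`, one needs

`∑_{y ≤ p < z} x ω(log x/log p − 1)/(p log p) = (x/log x)(u ω(u) − k ω(k)) + O_k(x/log² y)`.

* `integral_buchstabWeight_eq` — the main term: with `log z = (log x)/k`,
  `∫_y^z x ω(log x/log t − 1) dt/(t log² t) = (x/log x) ∫_{k−1}^{u−1} ω = (x/log x)(u ω(u) − k ω(k))`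
  (substitution `s = log x/log t − 1`, then the integral equation of `ω`);
* `abs_sum_sub_integral_le_of_three_le` (`k ≥ 3`: the weight is `C¹`, `ω` being `C¹` on `(2, ∞)`)
  and `abs_sum_sub_integral_le_two` (`k = 2`: there `ω(s) = 1/s` and the weight is
  `x/(t log t (log x − log t))`) — Abel summation through `ϑ`
  (`Literature.NumberTheory.LFunctions.abs_sum_prime_mul_log_sub_integral_le`) with the prime number
  theorem error `|ϑ(t) − t| ≤ C₀ t/log² t`.

The assembly with Buchstab's identity is `RoughNumbersBuchstab.lean`.

## References

* J. D. Lichtman, arXiv:2109.02851, §6.1, Lemma 6.1. [Lichtman2025LinearSieve]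
* G. Harman, *Prime-Detecting Sieves* (2007), §1.4 (1.4.14) and Appendix A.2.
-/

open Finset Real MeasureTheory Set intervalIntegral
open scoped Chebyshev

noncomputable section

namespace Literature.NumberTheory.Sieve

/-! ### The main term: substitution `s = log x/log t − 1` -/

/-- The substitution map `φ(t) = log x/log t − 1` has derivative `−log x/(t log² t)` at `t > 1`.
[folklore] -/
theorem hasDerivAt_logRatio_sub_one (x : ℝ) {t : ℝ} (ht : 1 < t) :
    HasDerivAt (fun s : ℝ => Real.log x / Real.log s - 1) (-Real.log x / (t * Real.log t ^ 2)) t := by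
  have ht0 : t ≠ 0 := by positivity
  have hl : Real.log t ≠ 0 := (Real.log_pos ht).ne'
  have h := ((hasDerivAt_const t (Real.log x)).fun_div (Real.hasDerivAt_log ht0) hl).sub_const 1
  refine h.congr_deriv ?_
  field_simp
  ring

/-- **The main term of the Buchstab iteration.** For `k ≥ 2`, `1 < y ≤ z` with
`log z = (log x)/k` and `u = log x/log y ≥ k`:
`∫_y^z x ω(log x/log t − 1)/(t log² t) dt = (x/log x)(u ω(u) − k ω(k))`
(substitute `s = log x/log t − 1`, `ds = −log x dt/(t log² t)`, then
`∫_{k−1}^{u−1} ω = ∫_k^u ω(v − 1) dv = u ω(u) − k ω(k)`; Harman §1.4, derivation of (1.4.14)).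
[cite: Lichtman2025LinearSieve, Lemma 6.1] -/
theorem integral_buchstabWeight_eq {x y z k : ℝ} (hk : 2 ≤ k) (hy : 1 < y) (hyz : y ≤ z)
    (hz : Real.log z = Real.log x / k) (hu : k ≤ Real.log x / Real.log y) :
    ∫ t in y..z, x * buchstabOmega (Real.log x / Real.log t - 1) / (t * Real.log t ^ 2) =
      x / Real.log x * (Real.log x / Real.log y * buchstabOmega (Real.log x / Real.log y) -
        k * buchstabOmega k) := by
  set u : ℝ := Real.log x / Real.log y with hu_def
  set φ : ℝ → ℝ := fun s => Real.log x / Real.log s - 1 with hφ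
  set φ' : ℝ → ℝ := fun s => -Real.log x / (s * Real.log s ^ 2) with hφ'
  have hly : 0 < Real.log y := Real.log_pos hy
  have hk0 : 0 < k := by linarith
  have hLx : 0 < Real.log x := by
    have : 0 < Real.log x / Real.log y := hk0.trans_le hu
    exact (div_pos_iff_of_pos_right hly).mp this
  have huIcc : uIcc y z = Icc y z := uIcc_of_le hyz
  have hmem : ∀ t ∈ Icc y z, 1 < t ∧ 0 < Real.log t ∧ k - 1 ≤ φ t := by
    intro t ht
    have ht1 : 1 < t := hy.trans_le ht.1
    have hlt : 0 < Real.log t := Real.log_pos ht1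
    refine ⟨ht1, hlt, ?_⟩
    have hz1 : Real.log t ≤ Real.log z := Real.log_le_log (by linarith) ht.2
    have : k ≤ Real.log x / Real.log t := by
      rw [le_div_iff₀ hlt]
      calc k * Real.log t ≤ k * Real.log z := by gcongr
        _ = Real.log x := by rw [hz]; field_simp
    simp only [hφ]; linarith
  -- the integrand is `(−x/log x) · (ω ∘ φ) · φ'`
  have hcongr : ∫ t in y..z, x * buchstabOmega (Real.log x / Real.log t - 1) / (t * Real.log t ^ 2) =
      ∫ t in y..z, (-x / Real.log x) * ((buchstabOmega ∘ φ) t * φ' t) := by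
    refine intervalIntegral.integral_congr fun t ht => ?_
    obtain ⟨ht1, hlt, -⟩ := hmem t (huIcc ▸ ht)
    have ht0 : t ≠ 0 := by positivity
    simp only [Function.comp, hφ, hφ']
    field_simp
  have hderiv : ∀ t ∈ uIcc y z, HasDerivAt φ (φ' t) t := fun t ht =>
    hasDerivAt_logRatio_sub_one x (hmem t (huIcc ▸ ht)).1
  have hcont : ContinuousOn φ' (uIcc y z) := by
    rw [huIcc]
    intro t ht
    obtain ⟨ht1, hlt, -⟩ := hmem t ht
    have h1 : t ≠ 0 := by positivity
    have h2 : t * Real.log t ^ 2 ≠ 0 := mul_ne_zero h1 (pow_ne_zero 2 hlt.ne')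
    refine ContinuousAt.continuousWithinAt ?_
    simp only [hφ']
    fun_prop (disch := assumption)
  have himage : φ '' uIcc y z ⊆ Ici 1 := by
    rw [huIcc]
    rintro _ ⟨t, ht, rfl⟩
    exact le_trans (by linarith) (hmem t ht).2.2
  have hsubst := intervalIntegral.integral_comp_mul_deriv' hderiv hcont
    (continuousOn_buchstabOmega.mono himage)
  have hφy : φ y = u - 1 := by simp only [hφ, hu_def]
  have hφz : φ z = k - 1 := by
    simp only [hφ]
    rw [hz]
    field_simp
  rw [hcongr, intervalIntegral.integral_const_mul, hsubst, hφy, hφz, intervalIntegral.integral_symm,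
    ← intervalIntegral.integral_comp_sub_right buchstabOmega 1,
    ← mul_buchstabOmega_sub_eq_integral hk hu]
  ring

/-! ### Abel summation for weights of size `x/(t log² t)` -/

/-- For `t ≥ a ≥ e`: `t > 0` and `log t ≥ 1`. [folklore] -/
private theorem pos_and_one_le_log' {a t : ℝ} (ha : Real.exp 1 ≤ a) (hat : a ≤ t) :
    0 < t ∧ 1 ≤ Real.log t := by
  have ht0 : 0 < t := (Real.exp_pos 1).trans_le (ha.trans hat)
  exact ⟨ht0, by rw [Real.le_log_iff_exp_le ht0]; exact ha.trans hat⟩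

/-- **Prime sums of a weight of size `x/(t log² t)`.** If `f ∈ C¹[a, b]` (`e ≤ a ≤ b`,
`log b ≤ 3 log a`) satisfies `|f(t)| ≤ x/(t log² t)` and `|f'(t)| ≤ K x/(t² log² t)` on `[a, b]`, and
`|ϑ(t) − t| ≤ C₀ t/log² t` (`t ≥ 2`), then
`|∑_{⌊a⌋ < p ≤ ⌊b⌋} f(p) log p − ∫_a^b f| ≤ (2 + 3K) C₀ x/log² a`
(the three error terms of `Literature.NumberTheory.LFunctions.abs_sum_prime_mul_log_sub_integral_le`
are `≤ C₀ x/log⁴ b`, `≤ C₀ x/log⁴ a` and `≤ K C₀ x log(b/a)/log⁴ a`). [folklore] -/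
theorem abs_sum_sub_integral_le_of_weight_bounds {f f' : ℝ → ℝ} {x a b C₀ K : ℝ} (hC₀ : 0 ≤ C₀)
    (hE : ∀ t : ℝ, 2 ≤ t → |θ t - t| ≤ C₀ * t / Real.log t ^ 2)
    (ha : Real.exp 1 ≤ a) (hab : a ≤ b) (hba : Real.log b ≤ 3 * Real.log a) (hx : 0 ≤ x)
    (hK : 0 ≤ K) (hf : ∀ t ∈ Icc a b, HasDerivAt f (f' t) t) (hf'c : ContinuousOn f' (Icc a b))
    (hfb : ∀ t ∈ Icc a b, |f t| ≤ x / (t * Real.log t ^ 2))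
    (hf'b : ∀ t ∈ Icc a b, |f' t| ≤ K * x / (t ^ 2 * Real.log t ^ 2)) :
    |∑ p ∈ (Finset.Ioc ⌊a⌋₊ ⌊b⌋₊).filter Nat.Prime, f p * Real.log p - ∫ t in a..b, f t| ≤
      (2 + 3 * K) * C₀ * x / Real.log a ^ 2 := by
  have hea : (2 : ℝ) ≤ a := le_trans (by have := Real.add_one_le_exp (1 : ℝ); linarith) ha
  have ha0 : 0 < a := by linarith
  obtain ⟨-, hla⟩ := pos_and_one_le_log' ha le_rfl
  have hb0 : 0 < b := ha0.trans_le hab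
  have hlab : Real.log a ≤ Real.log b := Real.log_le_log ha0 hab
  have hlb : 1 ≤ Real.log b := hla.trans hlab
  have hmain := Literature.NumberTheory.LFunctions.abs_sum_prime_mul_log_sub_integral_le
    hea hab hf hf'c hE
  have huIcc : uIcc a b = Icc a b := uIcc_of_le hab
  have hT1 : |f b| * (C₀ * b / Real.log b ^ 2) ≤ C₀ * x / Real.log a ^ 2 := by
    calc |f b| * (C₀ * b / Real.log b ^ 2) ≤ x / (b * Real.log b ^ 2) * (C₀ * b / Real.log b ^ 2) :=
          mul_le_mul_of_nonneg_right (hfb b ⟨hab, le_rfl⟩) (by positivity)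
      _ = C₀ * x / Real.log b ^ 2 * (Real.log b ^ 2)⁻¹ := by field_simp
      _ ≤ C₀ * x / Real.log a ^ 2 * 1 := by
          gcongr
          exact inv_le_one_of_one_le₀ (one_le_pow₀ hlb)
      _ = _ := mul_one _
  have hT2 : |f a| * (C₀ * a / Real.log a ^ 2) ≤ C₀ * x / Real.log a ^ 2 := by
    calc |f a| * (C₀ * a / Real.log a ^ 2) ≤ x / (a * Real.log a ^ 2) * (C₀ * a / Real.log a ^ 2) :=
          mul_le_mul_of_nonneg_right (hfb a ⟨le_rfl, hab⟩) (by positivity)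
      _ = C₀ * x / Real.log a ^ 2 * (Real.log a ^ 2)⁻¹ := by field_simp
      _ ≤ C₀ * x / Real.log a ^ 2 * 1 := by
          gcongr
          exact inv_le_one_of_one_le₀ (one_le_pow₀ hla)
      _ = _ := mul_one _
  have hT3 : ∫ t in a..b, |f' t| * (C₀ * t / Real.log t ^ 2) ≤ 3 * K * C₀ * x / Real.log a ^ 2 := by
    have hpt : ∀ t ∈ Icc a b, |f' t| * (C₀ * t / Real.log t ^ 2) ≤
        K * C₀ * x / Real.log a ^ 4 * t⁻¹ := by
      intro t ht
      obtain ⟨ht0, hlt⟩ := pos_and_one_le_log' ha ht.1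
      have hlat : Real.log a ≤ Real.log t := Real.log_le_log ha0 ht.1
      calc |f' t| * (C₀ * t / Real.log t ^ 2)
          ≤ K * x / (t ^ 2 * Real.log t ^ 2) * (C₀ * t / Real.log t ^ 2) :=
            mul_le_mul_of_nonneg_right (hf'b t ht) (by positivity)
        _ = K * C₀ * x / Real.log t ^ 4 * t⁻¹ := by field_simp
        _ ≤ K * C₀ * x / Real.log a ^ 4 * t⁻¹ := by gcongr
    have hcont : ContinuousOn (fun t => |f' t| * (C₀ * t / Real.log t ^ 2)) (Icc a b) := by
      refine (continuous_abs.comp_continuousOn hf'c).mul fun t ht => ?_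
      obtain ⟨ht0, hlt⟩ := pos_and_one_le_log' ha ht.1
      have h1 : t ≠ 0 := ht0.ne'
      have h2 : Real.log t ^ 2 ≠ 0 := pow_ne_zero 2 (by linarith)
      refine ContinuousAt.continuousWithinAt ?_
      fun_prop (disch := assumption)
    have hcont2 : ContinuousOn (fun t : ℝ => K * C₀ * x / Real.log a ^ 4 * t⁻¹) (Icc a b) :=
      continuousOn_const.mul (continuousOn_inv₀.mono fun t ht =>
        ne_of_gt (pos_and_one_le_log' ha ht.1).1)
    have hla4 : Real.log a ^ 4 = Real.log a ^ 2 * Real.log a ^ 2 := by ring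
    calc ∫ t in a..b, |f' t| * (C₀ * t / Real.log t ^ 2)
        ≤ ∫ t in a..b, K * C₀ * x / Real.log a ^ 4 * t⁻¹ :=
          intervalIntegral.integral_mono_on hab (hcont.mono huIcc.subset).intervalIntegrable
            (hcont2.mono huIcc.subset).intervalIntegrable hpt
      _ = K * C₀ * x / Real.log a ^ 4 * Real.log (b / a) := by
          rw [intervalIntegral.integral_const_mul, integral_inv_of_pos ha0 hb0]
      _ ≤ K * C₀ * x / Real.log a ^ 4 * (3 * Real.log a) := by
          refine mul_le_mul_of_nonneg_left ?_ (by positivity)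
          rw [Real.log_div hb0.ne' ha0.ne']; linarith
      _ = 3 * K * C₀ * x / Real.log a ^ 2 * (Real.log a / Real.log a ^ 2) := by
          rw [hla4]; field_simp
      _ ≤ 3 * K * C₀ * x / Real.log a ^ 2 * 1 := by
          gcongr
          rw [div_le_one (by positivity)]; nlinarith
      _ = _ := mul_one _
  calc _ ≤ _ := hmain
    _ ≤ C₀ * x / Real.log a ^ 2 + C₀ * x / Real.log a ^ 2 + 3 * K * C₀ * x / Real.log a ^ 2 := by
        linarith
    _ = (2 + 3 * K) * C₀ * x / Real.log a ^ 2 := by ring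

/-! ### The prime sum for `k = 2`: weight `x/(t log t (log x − log t))` -/

/-- **The prime sum of the Buchstab iteration, `k = 2`.** For `e ≤ a ≤ b`, `2 log b ≤ log x`,
`log b ≤ 3 log a`, `x ≥ 0` and `|ϑ(t) − t| ≤ C₀ t/log² t` (`t ≥ 2`):
`|∑_{⌊a⌋ < p ≤ ⌊b⌋} x/(p (log x − log p)) − ∫_a^b x dt/(t log t (log x − log t))| ≤ 38 C₀ x/log² a`
(on `y ≤ p < x^{1/2}` one has `1 < log x/log p − 1 ≤ 2`, where `ω(s) = 1/s`, so this is the sum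
`∑ x ω(log x/log p − 1)/(p log p)`; the weight is `C¹` with `|f| ≤ x/(t log² t)`,
`|f'| ≤ 12 x/(t² log² t)`). [cite: Lichtman2025LinearSieve, Lemma 6.1] -/
theorem abs_sum_sub_integral_le_two {x a b C₀ : ℝ} (hC₀ : 0 ≤ C₀)
    (hE : ∀ t : ℝ, 2 ≤ t → |θ t - t| ≤ C₀ * t / Real.log t ^ 2)
    (ha : Real.exp 1 ≤ a) (hab : a ≤ b) (hbx : 2 * Real.log b ≤ Real.log x)
    (hba : Real.log b ≤ 3 * Real.log a) (hx : 0 ≤ x) :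
    |∑ p ∈ (Finset.Ioc ⌊a⌋₊ ⌊b⌋₊).filter Nat.Prime, x / (p * (Real.log x - Real.log p)) -
        ∫ t in a..b, x / (t * Real.log t * (Real.log x - Real.log t))| ≤
      38 * C₀ * x / Real.log a ^ 2 := by
  have ha0 : 0 < a := (Real.exp_pos 1).trans_le ha
  have hb0 : 0 < b := ha0.trans_le hab
  set L := Real.log x with hL
  have hmem : ∀ t ∈ Icc a b, 0 < t ∧ 1 ≤ Real.log t ∧ Real.log t ≤ L - Real.log t := by
    intro t ht
    obtain ⟨ht0, hlt⟩ := pos_and_one_le_log' ha ht.1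
    have hltb : Real.log t ≤ Real.log b := Real.log_le_log ht0 ht.2
    exact ⟨ht0, hlt, by linarith⟩
  -- the weight, its derivative, and their bounds
  set f : ℝ → ℝ := fun t => x / (t * Real.log t * (L - Real.log t)) with hf_def
  set f' : ℝ → ℝ := fun t => -(x * ((Real.log t + 1) * (L - Real.log t) - Real.log t)) /
    (t * Real.log t * (L - Real.log t)) ^ 2 with hf'_def
  have hD : ∀ t ∈ Icc a b, t * Real.log t * Real.log t ≤ t * Real.log t * (L - Real.log t) ∧
      0 < t * Real.log t * (L - Real.log t) := by
    intro t ht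
    obtain ⟨ht0, hlt, hLt⟩ := hmem t ht
    have h1 : t * Real.log t * Real.log t ≤ t * Real.log t * (L - Real.log t) := by
      apply mul_le_mul_of_nonneg_left hLt; positivity
    exact ⟨h1, lt_of_lt_of_le (by positivity) h1⟩
  have hf : ∀ t ∈ Icc a b, HasDerivAt f (f' t) t := by
    intro t ht
    obtain ⟨ht0, hlt, hLt⟩ := hmem t ht
    have hDt := (hD t ht).2
    have hderD := ((hasDerivAt_id' t).fun_mul (Real.hasDerivAt_log ht0.ne')).fun_mul
      ((Real.hasDerivAt_log ht0.ne').const_sub L)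
    have h := (hasDerivAt_const t x).fun_div hderD hDt.ne'
    refine h.congr_deriv ?_
    have ht0' : t ≠ 0 := ht0.ne'
    have hD0 : t * Real.log t * (L - Real.log t) ≠ 0 := hDt.ne'
    rw [hf'_def]
    simp only
    field_simp
    ring
  have hf'c : ContinuousOn f' (Icc a b) := by
    intro t ht
    obtain ⟨ht0, hlt, hLt⟩ := hmem t ht
    have h1 : t ≠ 0 := ht0.ne'
    have h2 : (t * Real.log t * (L - Real.log t)) ^ 2 ≠ 0 := pow_ne_zero 2 (hD t ht).2.ne'
    refine ContinuousAt.continuousWithinAt ?_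
    rw [hf'_def]
    fun_prop (disch := assumption)
  have hfb : ∀ t ∈ Icc a b, |f t| ≤ x / (t * Real.log t ^ 2) := by
    intro t ht
    obtain ⟨ht0, hlt, hLt⟩ := hmem t ht
    obtain ⟨hD1, hD2⟩ := hD t ht
    rw [hf_def]
    simp only
    rw [abs_of_nonneg (div_nonneg hx hD2.le)]
    calc x / (t * Real.log t * (L - Real.log t)) ≤ x / (t * Real.log t * Real.log t) :=
          div_le_div_of_nonneg_left hx (by positivity) hD1
      _ = x / (t * Real.log t ^ 2) := by ring
  have hf'b : ∀ t ∈ Icc a b, |f' t| ≤ 12 * x / (t ^ 2 * Real.log t ^ 2) := by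
    intro t ht
    obtain ⟨ht0, hlt, hLt⟩ := hmem t ht
    obtain ⟨hD1, hD2⟩ := hD t ht
    have hL1 : 1 ≤ L := by linarith
    have hLt2 : L ≤ 2 * (L - Real.log t) := by linarith
    rw [hf'_def]
    simp only
    rw [abs_div, abs_neg, abs_of_pos (by positivity : (0 : ℝ) < (t * Real.log t * (L - Real.log t)) ^ 2),
      div_le_div_iff₀ (by positivity) (by positivity)]
    have hnum : |x * ((Real.log t + 1) * (L - Real.log t) - Real.log t)| ≤ x * (3 * L * Real.log t) := by
      rw [abs_mul, abs_of_nonneg hx]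
      refine mul_le_mul_of_nonneg_left ?_ hx
      rw [abs_le]
      constructor
      · nlinarith
      · nlinarith
    have hden : t ^ 2 * Real.log t ^ 2 * L ^ 2 ≤ 4 * (t * Real.log t * (L - Real.log t)) ^ 2 := by
      have : t * Real.log t * L ≤ 2 * (t * Real.log t * (L - Real.log t)) := by
        have := mul_le_mul_of_nonneg_left hLt2 (by positivity : 0 ≤ t * Real.log t); linarith
      nlinarith [this, mul_pos (mul_pos ht0 (by linarith : 0 < Real.log t)) (by linarith : 0 < L)]
    calc |x * ((Real.log t + 1) * (L - Real.log t) - Real.log t)| * (t ^ 2 * Real.log t ^ 2)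
        ≤ x * (3 * L * Real.log t) * (t ^ 2 * Real.log t ^ 2) := by gcongr
      _ = 3 * x * (Real.log t / L) * (t ^ 2 * Real.log t ^ 2 * L ^ 2) := by
          field_simp
      _ ≤ 3 * x * 1 * (4 * (t * Real.log t * (L - Real.log t)) ^ 2) := by
          gcongr
          · rw [div_le_one (by linarith)]; linarith
      _ = 12 * x * (t * Real.log t * (L - Real.log t)) ^ 2 := by ring
  have hres := abs_sum_sub_integral_le_of_weight_bounds hC₀ hE ha hab hba hx (by norm_num) hf hf'c
    hfb hf'b
  -- the prime sum is the one in the statement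
  have hsum : ∑ p ∈ (Finset.Ioc ⌊a⌋₊ ⌊b⌋₊).filter Nat.Prime, f p * Real.log p =
      ∑ p ∈ (Finset.Ioc ⌊a⌋₊ ⌊b⌋₊).filter Nat.Prime, x / (p * (L - Real.log p)) := by
    refine Finset.sum_congr rfl fun p hp => ?_
    have hp2 := (Finset.mem_filter.mp hp).2.two_le
    have hlp : Real.log p ≠ 0 := (Real.log_pos (by exact_mod_cast hp2)).ne'
    rw [hf_def]
    simp only
    rw [show (p : ℝ) * Real.log p * (L - Real.log p) = Real.log p * ((p : ℝ) * (L - Real.log p)) by ring,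
      div_mul_eq_mul_div, mul_comm x, mul_div_mul_left _ _ hlp]
  rw [hsum] at hres
  calc _ ≤ _ := hres
    _ = 38 * C₀ * x / Real.log a ^ 2 := by norm_num

end Literature.NumberTheory.Sieve
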